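import Literature.AnabelianGeometry.AbsoluteAnabelian.MLFClosureUnitsInfinitelyDivisible
import Mathlib.FieldTheory.Galois.Infinite

/-!
# The "intrinsically defined" units and integers of an MLF-Galois `TF`-pair
# ([AbsTopIII] Def 3.1 (iii) natural functors `𝒞_TF → 𝒞_TCG`, `𝒞_TF → 𝒞_TM` on objects; Rmk 3.1.1)

S. Mochizuki, *Topics in absolute anabelian geometry III*, §3 (bib key `MochizukiAbsTopIII2015`;
locators = kurims manuscript pages, lit key `paper:url-5493eb38cbb7`).  Def. 3.1 (iii) p. 68: "Since
the formation of `𝒪_k̄^⊳` (respectively, `k̄^×`; `𝒪_k̄^×`; `𝒪_k̄^×`) from `k̄` (respectively, `𝒪_k̄^⊳`; `𝒪_k̄^⊳`;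
`k̄^×`) is clearly intrinsically defined [i.e., depends only on the 'input data of an object of `T`'],
we thus obtain natural functors `𝒞^MLF_TF → 𝒞^MLF_TM`; `𝒞^MLF_TM → 𝒞^MLF_TLG`; `𝒞^MLF_TM → 𝒞^MLF_TCG`;
`𝒞^MLF_TLG → 𝒞^MLF_TCG`"; Rmk. 3.1.1 p. 70: "the fact that `𝒪_k̄^× ⊆ k̄^×` may be characterized as the
subgroup of elements divisible by arbitrary powers of some prime number" (at the finite levels).

The typed pairs of `MLFGaloisPairs.lean` (seat abc-iut-L4-t2) carry NO topology (Rmk. 3.1.1), and an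
abstract field `M ≅ k̄` alone does not determine `𝒪_k̄` (abstractly `k̄ ≅ ℂ`); what IS intrinsic to the
PAIR `(Π ↷ M)` is Rmk. 3.1.1's characterization, read at the finite levels cut out by stabilisers.
This file makes "intrinsically defined" precise and kernel-checked:

* `GaloisFieldPair.IsIntrinsicUnit P x` — `x ≠ 0` and, for some prime `ℓ`, `x` has `ℓ^n`-th roots FIXED BY
  THE STABILISER OF `x` IN `Π`, for every `n` (a first-order condition on the pair);
  `IsIntrinsicInteger P x := IsIntrinsicUnit x ∨ IsIntrinsicUnit (1 + x)` (a valuation ring is its units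
  together with its maximal ideal `𝔪 = {x | 1 + x ∈ 𝒪^×} ∖ 𝒪^×`); both are transported by isomorphisms of
  pairs (`isIntrinsicUnit_iff_of_iso`, `isIntrinsicInteger_iff_of_iso`) and stable under `Π`;
* MODEL COMPARISON (the content): for model data `(k, k̄, ε_k : Π_k ↠ G_k)`,
  `isIntrinsicUnit_fieldPair_iff : IsIntrinsicUnit (Π_k ↷ k̄) x ↔ x ∈ 𝒪_k̄^×` (= Rmk. 3.1.1, DISCHARGED by
  seat abc-iut-L6-t11 as `unitsAreInfinitelyDivisibleElements`, plus the Galois correspondence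
  `k̄^{Stab(x)} = k(x)`), and `isIntrinsicInteger_fieldPair_iff : IsIntrinsicInteger (Π_k ↷ k̄) x ↔ x ∈ 𝒪_k̄`
  (a non-unit integer `x` lies in the maximal ideal of the local field `k(x)`, so `1 + x` is a unit —
  the tree's `FiniteExtension` valuation theory);
* hence, for every MLF-Galois `TF`-pair `P` (Def. 3.1 (ii)), the SUBMONOIDS `P.intrinsicUnits hP = "𝒪^×"`
  and `P.intrinsicNonzeroIntegers hP = "𝒪^⊳"` of `P.M` (closure under multiplication transported from the
  model), i.e. the object parts of the natural functors `𝒞^MLF_TF → 𝒞^MLF_TCG`, `𝒞^MLF_TF → 𝒞^MLF_TM`,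
  with `map_unitSubmonoid_eq` / `map_nonzeroIntegers_eq`: any model isomorphism carries `𝒪_k̄^×`, `𝒪_k̄^⊳`
  onto them.

NOT here: the functors on morphisms (an equivariant field homomorphism between algebraic closures of
MLF's preserves units — again by Rmk. 3.1.1 at the finite levels; deferred), `𝒞_TM → 𝒞_TLG` (groupification)
and `𝒞_TM → 𝒞_TCG` (invertible elements), which are formal.
HONEST FRAMING: OUR kernel constructions/checks of classical valuation theory quoted by a refereed
paper; nothing here bears on [IUTchIII] Cor. 3.12.
-/

noncomputable section

universe u

namespace Literature.AnabelianGeometry.AbsoluteAnabelian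

open _root_.ValuativeRel
open Literature.NumberTheory.GaloisRepresentations

/-! ### Intrinsic units and integers of an abstract `TF`-pair -/

namespace GaloisFieldPair

variable (P : GaloisFieldPair.{u}) {Q : GaloisFieldPair.{u}}

/-- **Rmk 3.1.1 / Def 3.1 (iii), intrinsic form of `𝒪^×`.**  An element `x` of the arithmetic data `M`
(a field `≅ k̄`) of a `TF`-pair `(Π ↷ M)` is an **intrinsic unit** if `x ≠ 0` and, for some prime `ℓ`,
`x` admits, for every `n`, an `ℓ^n`-th root fixed by every element of `Π` that fixes `x` ("divisible by
arbitrary powers of some prime number" at the finite level cut out by the stabiliser of `x`).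
[cite: MochizukiAbsTopIII2015, Remark 3.1.1 p.70] -/
def IsIntrinsicUnit (x : P.M) : Prop :=
  x ≠ 0 ∧ ∃ ℓ : ℕ, ℓ.Prime ∧ ∀ n : ℕ, ∃ y : P.M, (∀ g : P.Pi, g • x = x → g • y = y) ∧ y ^ (ℓ ^ n) = x

/-- **Def 3.1 (iii), intrinsic form of `𝒪`**: `x` is an **intrinsic integer** if `x` or `1 + x` is an
intrinsic unit (a valuation ring is the union of its unit group and its maximal ideal, and `x` lies in
the maximal ideal iff `1 + x` is a unit while `x` is not). [cite: MochizukiAbsTopIII2015, Definition 3.1 (iii) p.68] -/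
def IsIntrinsicInteger (x : P.M) : Prop :=
  P.IsIntrinsicUnit x ∨ P.IsIntrinsicUnit (1 + x)

variable {P}

/-- The symmetric of an isomorphism of `TF`-pairs. [cite: MochizukiAbsTopIII2015, Definition 3.1 (ii) p.67] -/
def Iso.symm (e : GaloisFieldPair.Iso P Q) : GaloisFieldPair.Iso Q P where
  isoPi := e.isoPi.symm
  isoM := e.isoM.symm
  smul_comm g x := by
    apply e.isoM.injective
    rw [RingEquiv.apply_symm_apply, e.smul_comm, RingEquiv.apply_symm_apply,
      ContinuousMulEquiv.apply_symm_apply]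

/-- An isomorphism of pairs matches stabiliser-fixed elements: `y` is fixed by the stabiliser of `x`
iff `e y` is fixed by the stabiliser of `e x`. [cite: MochizukiAbsTopIII2015, Definition 3.1 (ii) p.67] -/
theorem Iso.forall_smul_eq_iff (e : GaloisFieldPair.Iso P Q) (x y : P.M) :
    (∀ g : P.Pi, g • x = x → g • y = y) ↔
      ∀ g : Q.Pi, g • e.isoM x = e.isoM x → g • e.isoM y = e.isoM y := by
  constructor
  · intro h g hg
    obtain ⟨g₀, rfl⟩ := e.isoPi.surjective g
    rw [← e.smul_comm] at hg ⊢
    rw [h g₀ (e.isoM.injective hg)]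
  · intro h g hg
    have h1 := h (e.isoPi g) (by rw [← e.smul_comm, hg])
    rw [← e.smul_comm] at h1
    exact e.isoM.injective h1

/-- **Intrinsic units are transported by isomorphisms of pairs** (the sense in which the formation of
`𝒪^×` "depends only on the input data of an object of `T`"). [cite: MochizukiAbsTopIII2015, Definition 3.1 (iii) p.68] -/
theorem isIntrinsicUnit_iff_of_iso (e : GaloisFieldPair.Iso P Q) (x : P.M) :
    P.IsIntrinsicUnit x ↔ Q.IsIntrinsicUnit (e.isoM x) := by
  unfold IsIntrinsicUnit
  rw [e.isoM.map_ne_zero_iff]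
  refine and_congr_right fun _ => exists_congr fun ℓ => and_congr_right fun _ =>
    forall_congr' fun n => ?_
  constructor
  · rintro ⟨y, hy, hyx⟩
    exact ⟨e.isoM y, (e.forall_smul_eq_iff x y).mp hy, by rw [← map_pow, hyx]⟩
  · rintro ⟨y', hy', hy'x⟩
    refine ⟨e.isoM.symm y', (e.forall_smul_eq_iff x _).mpr (by simpa using hy'), ?_⟩
    apply e.isoM.injective
    rw [map_pow, RingEquiv.apply_symm_apply, hy'x]

/-- Intrinsic integers are transported by isomorphisms of pairs. [cite: MochizukiAbsTopIII2015, Definition 3.1 (iii) p.68] -/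
theorem isIntrinsicInteger_iff_of_iso (e : GaloisFieldPair.Iso P Q) (x : P.M) :
    P.IsIntrinsicInteger x ↔ Q.IsIntrinsicInteger (e.isoM x) := by
  unfold IsIntrinsicInteger
  rw [isIntrinsicUnit_iff_of_iso e x, isIntrinsicUnit_iff_of_iso e (1 + x), map_add, map_one]

/-- Intrinsic units are stable under the action of `Π` (the stabiliser of `g • x` is the conjugate of
that of `x`). [cite: MochizukiAbsTopIII2015, Definition 3.1 (iii) p.68] -/
theorem IsIntrinsicUnit.smul {x : P.M} (hx : P.IsIntrinsicUnit x) (g : P.Pi) :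
    P.IsIntrinsicUnit (g • x) := by
  obtain ⟨hx0, ℓ, hℓ, h⟩ := hx
  refine ⟨fun h0 => hx0 (by simpa using congrArg (fun z => g⁻¹ • z) h0), ℓ, hℓ, fun n => ?_⟩
  obtain ⟨y, hy, hyx⟩ := h n
  refine ⟨g • y, fun g' hg' => ?_, by rw [← smul_pow', hyx]⟩
  have h1 : (g⁻¹ * g' * g) • x = x := by
    rw [mul_smul, mul_smul, hg', inv_smul_smul]
  have h2 := hy _ h1
  rw [mul_smul, mul_smul, inv_smul_eq_iff] at h2
  exact h2

/-- Intrinsic integers are stable under the action of `Π`. [cite: MochizukiAbsTopIII2015, Definition 3.1 (iii) p.68] -/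
theorem IsIntrinsicInteger.smul {x : P.M} (hx : P.IsIntrinsicInteger x) (g : P.Pi) :
    P.IsIntrinsicInteger (g • x) := by
  rcases hx with h | h
  · exact Or.inl (h.smul g)
  · refine Or.inr ?_
    rw [show (1 : P.M) + g • x = g • (1 + x) by rw [smul_add, smul_one]]
    exact h.smul g

end GaloisFieldPair

/-! ### Model comparison: on `(Π_k ↷ k̄)` the intrinsic units / integers are `𝒪_k̄^×` / `𝒪_k̄` -/

section Model

variable (C : MLFClosure.{u}) (D : ModelMLFGaloisData C.k C.K)

namespace ModelMLFGaloisData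

/-- `IsIntrinsicUnit` on the model `TF`-pair, unfolded in terms of `k̄` and `ε_k` (definitional).
[cite: MochizukiAbsTopIII2015, Remark 3.1.1 p.70] -/
theorem isIntrinsicUnit_fieldPair_iff_aux (x : C.K) :
    D.fieldPair.IsIntrinsicUnit x ↔
      x ≠ 0 ∧ ∃ ℓ : ℕ, ℓ.Prime ∧ ∀ n : ℕ, ∃ y : C.K,
        (∀ g : D.Pi, D.aug g • x = x → D.aug g • y = y) ∧ y ^ (ℓ ^ n) = x :=
  Iff.rfl

/-- **Galois correspondence at the level `k(x)`**: an element `y ∈ k̄` is fixed by the stabiliser of `x`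
in `Π_k` (acting through `ε_k : Π_k ↠ G_k`) iff `y ∈ k(x)`.
[cite: MochizukiAbsTopIII2015, Remark 3.1.1 p.70] -/
theorem forall_stabilizer_smul_eq_iff_mem_adjoin (x y : C.K) :
    (∀ g : D.Pi, D.aug g • x = x → D.aug g • y = y) ↔
      y ∈ IntermediateField.adjoin C.k ({x} : Set C.K) := by
  constructor
  · intro h
    rw [← InfiniteGalois.fixedField_fixingSubgroup (IntermediateField.adjoin C.k ({x} : Set C.K)),
      IntermediateField.mem_fixedField_iff]
    intro σ hσ
    obtain ⟨g, rfl⟩ := D.aug_surjective σ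
    have hx : D.aug g • x = x := (IntermediateField.mem_fixingSubgroup_iff _ _).mp hσ x
      (IntermediateField.mem_adjoin_simple_self C.k x)
    exact h g hx
  · intro hy g hgx
    exact (IntermediateField.forall_mem_adjoin_smul_eq_self_iff (F := C.k) (S := ({x} : Set C.K))
      (D.aug g)).mpr (fun z hz => by rw [Set.mem_singleton_iff.mp hz]; exact hgx) y hy

/-- **Rmk 3.1.1 for the model, intrinsic form**: an element of `k̄` is an intrinsic unit of the model
`TF`-pair `(Π_k ↷ k̄)` iff it lies in `𝒪_k̄^×` ("the subgroup of elements divisible by arbitrary powers of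
some prime number"; seat abc-iut-L6-t11's `unitsAreInfinitelyDivisibleElements` + the Galois
correspondence `k̄^{Stab(x)} = k(x)`). [cite: MochizukiAbsTopIII2015, Remark 3.1.1 p.70] -/
theorem isIntrinsicUnit_fieldPair_iff (x : C.K) :
    D.fieldPair.IsIntrinsicUnit x ↔ x ∈ unitSubmonoid C.k C.K := by
  rw [D.isIntrinsicUnit_fieldPair_iff_aux C x]
  rcases eq_or_ne x 0 with rfl | hx0
  · exact ⟨fun h => absurd rfl h.1, fun h => absurd rfl (unitSubmonoid_le_nonzeroIntegers h).2⟩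
  rw [C.mem_unitSubmonoid_iff_exists_prime_forall_exists_pow_eq hx0]
  refine ⟨fun h => ?_, fun h => ⟨hx0, ?_⟩⟩
  · obtain ⟨-, ℓ, hℓ, hn⟩ := h
    refine ⟨ℓ, hℓ, fun n => ?_⟩
    obtain ⟨y, hy, hyx⟩ := hn n
    exact ⟨y, (D.forall_stabilizer_smul_eq_iff_mem_adjoin C x y).mp hy, hyx⟩
  · obtain ⟨ℓ, hℓ, hn⟩ := h
    refine ⟨ℓ, hℓ, fun n => ?_⟩
    obtain ⟨y, hy, hyx⟩ := hn n
    exact ⟨y, (D.forall_stabilizer_smul_eq_iff_mem_adjoin C x y).mpr hy, hyx⟩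

/-- A non-unit integer `x ∈ 𝒪_k̄ ∖ 𝒪_k̄^×` lies in the maximal ideal of the local field `k(x)`, so `1 + x`
is a unit of `𝒪_k̄` (valuation `1` in `k(x)`). Ref: Serre, *Local Fields*, Ch. II §2.
[cite: MochizukiAbsTopIII2015, Definition 3.1 (i) p.66] -/
theorem one_add_mem_unitSubmonoid_of_mem_integersClosure {x : C.K} (hx : x ∈ integersClosure C.k C.K)
    (hxu : x ∉ unitSubmonoid C.k C.K) : 1 + x ∈ unitSubmonoid C.k C.K := by
  have hxk : IsIntegral C.k x := (Algebra.IsAlgebraic.isAlgebraic x).isIntegral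
  set E : IntermediateField C.k C.K := IntermediateField.adjoin C.k ({x} : Set C.K) with hE
  haveI : FiniteDimensional C.k E := IntermediateField.adjoin.finiteDimensional hxk
  letI := FiniteExtension.valuativeRel C.k E
  letI := FiniteExtension.topologicalSpace C.k E
  haveI := FiniteExtension.isNonarchimedeanLocalField C.k E
  set gx : E := IntermediateField.AdjoinSimple.gen C.k x with hgx
  -- `v(x) ≤ 1` and `v(x) ≠ 1`, in `k(x)`
  have hle : valuation (E : Type u) gx ≤ 1 := by
    have hint : IsIntegral 𝒪[C.k] gx :=
      (IntermediateField.isIntegral_coe_iff C.k C.K E gx).mp hx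
    have hmem : gx ∈ 𝒪[(E : Type u)] := (FiniteExtension.mem_integer_iff_isIntegral C.k E gx).mpr hint
    exact (Valuation.mem_integer_iff _ _).mp hmem
  have hne : valuation (E : Type u) gx ≠ 1 := fun h1 =>
    hxu ((mem_unitSubmonoid_iff_valuation_adjoin_eq_one C.k C.K hxk).mpr h1)
  have hlt : valuation (E : Type u) gx < 1 := lt_of_le_of_ne hle hne
  have h1 : valuation (E : Type u) (1 + gx) = 1 := Valuation.map_one_add_of_lt _ hlt
  have h0 : (1 + gx : E) ≠ 0 := fun h => by
    rw [h, map_zero] at h1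
    exact zero_ne_one h1
  obtain ⟨hi, hii⟩ :=
    (FiniteExtension.valuation_eq_one_iff_isIntegral_and_isIntegral_inv C.k E h0).mp h1
  have hcoe : ((1 + gx : E) : C.K) = 1 + x := by simp [hgx]
  rw [mem_unitSubmonoid_iff]
  refine ⟨fun h => h0 (Subtype.ext (by rw [hcoe]; simpa using h)), ?_, ?_⟩
  · rw [← hcoe]
    exact (IntermediateField.isIntegral_coe_iff C.k C.K E (1 + gx)).mpr hi
  · have := (IntermediateField.isIntegral_coe_iff C.k C.K E (1 + gx)⁻¹).mpr hii
    rw [← hcoe]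
    simpa using this

/-- `IsIntrinsicInteger` on the model `TF`-pair, unfolded (definitional).
[cite: MochizukiAbsTopIII2015, Definition 3.1 (iii) p.68] -/
theorem isIntrinsicInteger_fieldPair_iff_aux (x : C.K) :
    D.fieldPair.IsIntrinsicInteger x ↔
      D.fieldPair.IsIntrinsicUnit x ∨ D.fieldPair.IsIntrinsicUnit ((1 : C.K) + x) :=
  Iff.rfl

/-- **Def 3.1 (iii) for the model, intrinsic form of `𝒪_k̄`**: an element of `k̄` is an intrinsic integer
of `(Π_k ↷ k̄)` iff it lies in `𝒪_k̄` (the integral closure of `𝒪_k` in `k̄`).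
[cite: MochizukiAbsTopIII2015, Definition 3.1 (iii) p.68] -/
theorem isIntrinsicInteger_fieldPair_iff (x : C.K) :
    D.fieldPair.IsIntrinsicInteger x ↔ x ∈ integersClosure C.k C.K := by
  rw [D.isIntrinsicInteger_fieldPair_iff_aux C x, D.isIntrinsicUnit_fieldPair_iff C x,
    D.isIntrinsicUnit_fieldPair_iff C (1 + x)]
  constructor
  · rintro (h | h)
    · exact h.1
    · have h1 : (1 + x) - 1 ∈ integersClosure C.k C.K :=
        Subalgebra.sub_mem _ h.1 (Subalgebra.one_mem _)
      simpa using h1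
  · intro hx
    by_cases hxu : x ∈ unitSubmonoid C.k C.K
    · exact Or.inl hxu
    · exact Or.inr (one_add_mem_unitSubmonoid_of_mem_integersClosure C hx hxu)

/-- Hence: an element of `k̄` is a non-zero intrinsic integer of `(Π_k ↷ k̄)` iff it lies in `𝒪_k̄^⊳`.
[cite: MochizukiAbsTopIII2015, Definition 3.1 (iii) p.68] -/
theorem ne_zero_and_isIntrinsicInteger_fieldPair_iff (x : C.K) :
    (x ≠ 0 ∧ D.fieldPair.IsIntrinsicInteger x) ↔ x ∈ nonzeroIntegers C.k C.K := by
  rw [D.isIntrinsicInteger_fieldPair_iff C x]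
  exact ⟨fun h => ⟨h.2, h.1⟩, fun h => ⟨h.2, h.1⟩⟩

end ModelMLFGaloisData

end Model

/-! ### The natural functors `𝒞^MLF_TF → 𝒞^MLF_TCG`, `𝒞^MLF_TF → 𝒞^MLF_TM` on objects -/

namespace GaloisFieldPair

variable (P : GaloisFieldPair.{u}) (hP : IsMLFGaloisFieldPair P)

/-- **Def 3.1 (iii), `𝒞^MLF_TF → 𝒞^MLF_TCG` on objects**: the intrinsic unit group "`𝒪^×`" of an MLF-Galois
`TF`-pair, as a submonoid of its arithmetic data (closure under multiplication is transported from a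
model, where it is `𝒪_k̄^×`). [cite: MochizukiAbsTopIII2015, Definition 3.1 (iii) p.68] -/
def intrinsicUnits : Submonoid P.M where
  carrier := {x | P.IsIntrinsicUnit x}
  one_mem' := by
    obtain ⟨C, D, ⟨e⟩⟩ := hP.exists_model
    have h1 : D.fieldPair.IsIntrinsicUnit (1 : D.fieldPair.M) :=
      (D.isIntrinsicUnit_fieldPair_iff C 1).mpr (Submonoid.one_mem _)
    have h := (isIntrinsicUnit_iff_of_iso e (1 : D.fieldPair.M)).mp h1
    rwa [map_one] at h
  mul_mem' {a b} ha hb := by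
    obtain ⟨C, D, ⟨e⟩⟩ := hP.exists_model
    have ha' : (e.isoM.symm a : C.K) ∈ unitSubmonoid C.k C.K :=
      (D.isIntrinsicUnit_fieldPair_iff C _).mp ((isIntrinsicUnit_iff_of_iso e.symm a).mp ha)
    have hb' : (e.isoM.symm b : C.K) ∈ unitSubmonoid C.k C.K :=
      (D.isIntrinsicUnit_fieldPair_iff C _).mp ((isIntrinsicUnit_iff_of_iso e.symm b).mp hb)
    have hab : D.fieldPair.IsIntrinsicUnit (e.isoM.symm a * e.isoM.symm b) :=
      (D.isIntrinsicUnit_fieldPair_iff C _).mpr (Submonoid.mul_mem _ ha' hb')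
    have h := (isIntrinsicUnit_iff_of_iso e _).mp hab
    rwa [map_mul, RingEquiv.apply_symm_apply, RingEquiv.apply_symm_apply] at h

/-- Membership in `intrinsicUnits`. [cite: MochizukiAbsTopIII2015, Definition 3.1 (iii) p.68] -/
@[simp] theorem mem_intrinsicUnits (x : P.M) : x ∈ P.intrinsicUnits hP ↔ P.IsIntrinsicUnit x := Iff.rfl

/-- **Def 3.1 (iii), `𝒞^MLF_TF → 𝒞^MLF_TM` on objects**: the intrinsic monoid "`𝒪^⊳`" of non-zero integers
of an MLF-Galois `TF`-pair, as a submonoid of its arithmetic data.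
[cite: MochizukiAbsTopIII2015, Definition 3.1 (iii) p.68] -/
def intrinsicNonzeroIntegers : Submonoid P.M where
  carrier := {x | x ≠ 0 ∧ P.IsIntrinsicInteger x}
  one_mem' := ⟨one_ne_zero, Or.inl ((P.mem_intrinsicUnits hP 1).mp (Submonoid.one_mem _))⟩
  mul_mem' {a b} ha hb := by
    obtain ⟨C, D, ⟨e⟩⟩ := hP.exists_model
    refine ⟨mul_ne_zero ha.1 hb.1, ?_⟩
    have ha' : (e.isoM.symm a : C.K) ∈ integersClosure C.k C.K :=
      (D.isIntrinsicInteger_fieldPair_iff C _).mp ((isIntrinsicInteger_iff_of_iso e.symm a).mp ha.2)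
    have hb' : (e.isoM.symm b : C.K) ∈ integersClosure C.k C.K :=
      (D.isIntrinsicInteger_fieldPair_iff C _).mp ((isIntrinsicInteger_iff_of_iso e.symm b).mp hb.2)
    have hab : D.fieldPair.IsIntrinsicInteger (e.isoM.symm a * e.isoM.symm b) :=
      (D.isIntrinsicInteger_fieldPair_iff C _).mpr (Subalgebra.mul_mem _ ha' hb')
    have h := (isIntrinsicInteger_iff_of_iso e _).mp hab
    rwa [map_mul, RingEquiv.apply_symm_apply, RingEquiv.apply_symm_apply] at h

/-- Membership in `intrinsicNonzeroIntegers`. [cite: MochizukiAbsTopIII2015, Definition 3.1 (iii) p.68] -/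
@[simp] theorem mem_intrinsicNonzeroIntegers (x : P.M) :
    x ∈ P.intrinsicNonzeroIntegers hP ↔ x ≠ 0 ∧ P.IsIntrinsicInteger x := Iff.rfl

/-- `𝒪^× ⊆ 𝒪^⊳` intrinsically. [cite: MochizukiAbsTopIII2015, Definition 3.1 (iii) p.68] -/
theorem intrinsicUnits_le_intrinsicNonzeroIntegers :
    P.intrinsicUnits hP ≤ P.intrinsicNonzeroIntegers hP :=
  fun _ hx => ⟨hx.1, Or.inl hx⟩

end GaloisFieldPair

section ModelTransport

variable (C : MLFClosure.{u}) (D : ModelMLFGaloisData C.k C.K) {P : GaloisFieldPair.{u}}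
  (hP : IsMLFGaloisFieldPair P)

/-- **Naturality on the model**: an isomorphism `(Π_k ↷ k̄) ⥲ P` carries `𝒪_k̄^×` onto the intrinsic
units of `P` (so the object part of `𝒞_TF → 𝒞_TCG` agrees with Def. 3.1 (i) on model pairs).
[cite: MochizukiAbsTopIII2015, Definition 3.1 (iii) p.68] -/
theorem map_unitSubmonoid_eq_intrinsicUnits (e : GaloisFieldPair.Iso D.fieldPair P) :
    Submonoid.map e.isoM (unitSubmonoid C.k C.K) = P.intrinsicUnits hP := by
  ext y
  rw [Submonoid.mem_map]
  constructor
  · rintro ⟨x, hx, rfl⟩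
    exact (GaloisFieldPair.isIntrinsicUnit_iff_of_iso e x).mp ((D.isIntrinsicUnit_fieldPair_iff C x).mpr hx)
  · intro hy
    refine ⟨e.isoM.symm y, ?_, e.isoM.apply_symm_apply y⟩
    exact (D.isIntrinsicUnit_fieldPair_iff C _).mp ((GaloisFieldPair.isIntrinsicUnit_iff_of_iso e.symm y).mp hy)

/-- **Naturality on the model**: an isomorphism `(Π_k ↷ k̄) ⥲ P` carries `𝒪_k̄^⊳` onto the intrinsic non-zero
integers of `P` (object part of `𝒞_TF → 𝒞_TM`). [cite: MochizukiAbsTopIII2015, Definition 3.1 (iii) p.68] -/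
theorem map_nonzeroIntegers_eq_intrinsicNonzeroIntegers (e : GaloisFieldPair.Iso D.fieldPair P) :
    Submonoid.map e.isoM (nonzeroIntegers C.k C.K) = P.intrinsicNonzeroIntegers hP := by
  ext y
  rw [Submonoid.mem_map]
  constructor
  · rintro ⟨x, hx, rfl⟩
    obtain ⟨hx0, hxi⟩ := (D.ne_zero_and_isIntrinsicInteger_fieldPair_iff C x).mpr hx
    exact ⟨(e.isoM.map_ne_zero_iff).mpr hx0, (GaloisFieldPair.isIntrinsicInteger_iff_of_iso e x).mp hxi⟩
  · rintro ⟨hy0, hy⟩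
    refine ⟨e.isoM.symm y, ?_, e.isoM.apply_symm_apply y⟩
    exact (D.ne_zero_and_isIntrinsicInteger_fieldPair_iff C _).mp
      ⟨(e.isoM.symm.map_ne_zero_iff).mpr hy0,
        (GaloisFieldPair.isIntrinsicInteger_iff_of_iso e.symm y).mp hy⟩

end ModelTransport

end Literature.AnabelianGeometry.AbsoluteAnabelian

end
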